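import Summits.CriticalPhenomena.SAWScalingLimit.Theorems.CriticalBubbleBound.Negative.CriticalBubbleBoundBubbleConditionFalse
import Literature.Probability.RandomPlanarGeometry.SAWRatioLimit

/-!
# Negative-side results for the crux `SAWTotalPositivity.CriticalBubbleBound` (stmt-CriticalPhenomena-7117):
the DIMENSION ledger (work-file §19)

The crux in dimension `d` (`CriticalBubbleBoundDim d : ∀ e ∼ 0, G_{z_c(d)}(e) < ∞` on `ℤ^d`, the
catalogue's `twoPointENN`): `d = 2` IS the crux (`criticalBubbleBoundDim_two_iff`, work-file §15);
`d = 1` is TRIVIALLY TRUE (`criticalBubbleBoundDim_one`: self-avoiding walks of `ℤ` are monotone —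
the tree's `Zd.apply_eq_mul_of_mem_saws_one` — so `c_n(0,±1) = [n = 1]`); `d ≥ 5` is TRUE given the
vendored Hara–Slade bubble condition (`criticalBubbleBoundDim_of_haraSlade`, through
`criticalBubbleBoundDim_of_bubbleCondition : BubbleCondition d → CriticalBubbleBoundDim d`, an
implication that is void at `d = 2` by `not_bubbleCondition_two`). Nothing soft separates `d = 2`
from `d = 3, 4`, where the statement is equally open (Madras–Slade p. 37).

Refuter `cdisprove` (standing adversary, gen 4); the full indexed work file is
`Summits/CriticalPhenomena/SAWScalingLimit/Cruxes/CriticalBubbleBound/Disproof.lean` (§19).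
-/

noncomputable section

open MeasureTheory Filter Topology Set Function
open Literature.Probability.LatticeModels
open Literature.Probability.RandomPlanarGeometry Literature.Probability.RandomPlanarGeometry.SAW
open scoped ENNReal NNReal BigOperators

namespace Summit.CriticalPhenomena.SAWScalingLimit.Theorems.CriticalBubbleBound.Negative

open Summit.CriticalPhenomena.SAWScalingLimit.Theses.SAWTotalPositivity (CriticalBubbleBound)
open Literature.Barriers.CriticalPhenomena (twoPointENN bubbleDiagram BubbleCondition
  HaraSlade1992_bubbleCondition)

/-! ## §19 The DIMENSION ledger: the same statement on `ℤ^d` — `d = 1` trivial, `d ≥ 5` a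
(vendored) theorem, `d = 2` the crux, `d = 3, 4` equally open -/

/-- The crux in dimension `d`, in the catalogue's vocabulary (§15): the critical nearest-neighbour
two-point function of `ℤ^d` is finite, `∀ e ∼ 0, G_{z_c(d)}(e) < ∞`. -/
def CriticalBubbleBoundDim (d : ℕ) : Prop :=
  ∀ e : Site d, (zdGraph d).Adj 0 e → twoPointENN d (Zd.criticalPoint d) e < ⊤

/-- `d = 2` IS the crux (§15). [cite: MadrasSlade1993, §1.4] -/
theorem criticalBubbleBoundDim_two_iff : CriticalBubbleBoundDim 2 ↔ CriticalBubbleBound :=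
  criticalBubbleBound_iff_twoPointENN_lt_top.symm

/-- `G_z(e)² ≤ B(z)` in every dimension. [cite: Slade2006LaceExpansion, §2.2, eq. (2.30)] -/
theorem twoPointENN_sq_le_bubbleDiagram (d : ℕ) (z : ℝ) (e : Site d) :
    twoPointENN d z e ^ 2 ≤ bubbleDiagram d z := by
  rw [bubbleDiagram]
  exact ENNReal.le_tsum e

/-- The bubble CONDITION implies the statement in any dimension (how it is known for `d ≥ 5`;
void for `d = 2` by `not_bubbleCondition_two`, §15). [cite: MadrasSlade1993, Definition 1.5.1 and §1.5 p. 22] -/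
theorem criticalBubbleBoundDim_of_bubbleCondition {d : ℕ} (h : BubbleCondition d) :
    CriticalBubbleBoundDim d := by
  intro e _
  have h2 : twoPointENN d (Zd.criticalPoint d) e ^ 2 < ⊤ :=
    lt_of_le_of_lt (twoPointENN_sq_le_bubbleDiagram d _ e) h
  by_contra htop
  rw [not_lt, top_le_iff] at htop
  rw [htop, ENNReal.top_pow two_ne_zero] at h2
  exact lt_irrefl _ h2

/-- **`d ≥ 5`: a THEOREM in print** (Hara–Slade 1992, the tree's named fact
`HaraSlade1992_bubbleCondition`, vendored; its discharge chain lives in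
`Literature/Barriers/CriticalPhenomena/LaceExpansionBubbleFiveDim*.lean`). [cite: MadrasSlade1993, Theorem 6.1.6 and Corollary 6.1.7] -/
theorem criticalBubbleBoundDim_of_haraSlade (h : HaraSlade1992_bubbleCondition) {d : ℕ} (hd : 5 ≤ d) :
    CriticalBubbleBoundDim d :=
  criticalBubbleBoundDim_of_bubbleCondition (h d hd)

/-! ### `d = 1`: self-avoiding walks of `ℤ` are monotone -/

/-- On `ℤ¹` a SAW from `0` to a NEIGHBOUR has length exactly `1`: `c_n(0,e) = 0` for `n ≠ 1`
(the tree's `Zd.apply_eq_mul_of_mem_saws_one`: a SAW of `ℤ` is `i ↦ s·i`, `s = ±1`). [folklore] -/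
theorem countAt_dim_one_eq_zero {n : ℕ} (hn : n ≠ 1) {e : Site 1} (he : (zdGraph 1).Adj 0 e) :
    Zd.countAt 1 n e = 0 := by
  classical
  rw [← Zd.card_sawFun, Finset.card_eq_zero, Finset.eq_empty_iff_forall_notMem]
  intro ω hω
  rw [Zd.mem_sawFun_iff_mem_saws] at hω
  obtain ⟨hω, hωn⟩ := hω
  rcases Nat.eq_zero_or_pos n with rfl | hpos
  · have h0 : ω 0 = 0 := (Zd.mem_saws.1 hω).1
    rw [h0] at hωn
    exact he.ne hωn
  · obtain ⟨hs, hlin⟩ := Zd.apply_eq_mul_of_mem_saws_one hω hpos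
    have h := hlin n le_rfl
    rw [hωn] at h
    have he' := Zd.apply_zero_of_adj_one he
    simp only [Pi.zero_apply, zero_add, zero_sub] at he'
    rcases hs with hs | hs <;> rw [hs] at h <;> rcases he' with he' | he' <;> rw [he'] at h <;> omega

/-- **`d = 1`: TRIVIALLY TRUE** — `G_z(0,±1) = z` for every fugacity (the only SAW of `ℤ` from
`0` to `±1` is the single step), in particular at `z_c(1)`. The difficulty of the crux is
specific to `2 ≤ d ≤ 4`. [folklore] -/
theorem criticalBubbleBoundDim_one : CriticalBubbleBoundDim 1 := by
  intro e he
  rw [twoPointENN, tsum_eq_single 1]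
  · exact ENNReal.mul_lt_top (ENNReal.natCast_lt_top _) (ENNReal.pow_lt_top ENNReal.ofReal_lt_top)
  · intro n hn
    rw [countAt_dim_one_eq_zero hn he]
    simp

/-- **DIMENSION LEDGER** (summary): `d = 1` true (above); `d ≥ 5` true given the vendored
Hara–Slade fact; `d = 2` is `CriticalBubbleBound` (§15); nothing here separates `d = 2` from
`d = 3, 4`, where the statement is equally open (Madras–Slade p. 37) — so no proof of the crux
can be a soft argument valid in all dimensions `≤ 4` unless it also settles `d = 3, 4`, and no
disproof can be a soft low-dimensional argument unless it fails for `d = 1`. [cite: MadrasSlade1993, §1.4] -/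
theorem dimension_ledger (h : HaraSlade1992_bubbleCondition) :
    CriticalBubbleBoundDim 1 ∧ (∀ d, 5 ≤ d → CriticalBubbleBoundDim d) ∧
      (CriticalBubbleBoundDim 2 ↔ CriticalBubbleBound) :=
  ⟨criticalBubbleBoundDim_one, fun _ hd => criticalBubbleBoundDim_of_haraSlade h hd,
    criticalBubbleBoundDim_two_iff⟩

end Summit.CriticalPhenomena.SAWScalingLimit.Theorems.CriticalBubbleBound.Negative
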